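import Summits.CriticalPhenomena.CardyFormulaZ2.Theorems.CardySusyWardDiscretisationFamilyExistsSelection
import HarnessLib

/-!
# Selection of a clean non-degenerate cut edge, II: the central column and event rows — helper for `DiscretisationFamilyExists` (stmt-CriticalPhenomena-9644)

Continuation of `…ExistsSelection` (same coordinates and vocabulary).  `select_east`: from the event
rows `e₀, e₁, e₂` of the columns `j₀, j₀+1, j₀+2` (rows above clean up to `R`, event cell not
clean, room `eᵢ + 4 ≤ R`, `e₁` maximal) and the central column NOT west-degenerate, one of seven
clean crossings exists (straight at the bottom of column `j₀`, `j₀+1` or `j₀+2`; wide L from column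
`j₀` or `j₀+1`; hook from column `j₀+1` or `j₀+2`): a face-boundary bottom edge of the central
column is either non-degenerate (done), west-degenerate (excluded), or east-degenerate
(`resolve_degII`); a chord below the central column forces a non-inner cell east of its east end,
whence column `j₀+1` ends one row lower or higher at a face-boundary edge which is non-degenerate or
east-degenerate (`resolve_degII` again; a west-degenerate end is impossible next to the two inner
cells of the central column, `not_degenerate_west_of_inner`).  `exists_event` / `clean_of_deep`
produce the event rows from a deep block of inner cells at the top and a row of non-inner cells at
the bottom; `select_east_of_deep` packages everything.
-/

noncomputable section

open Set Metric Complex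
open Literature.Probability.LatticeModels Literature.Probability.Percolation
  Literature.Probability.LatticeModels.Mesh Literature.Probability.LatticeModels.DiscreteDobrushin

namespace Summit.CriticalPhenomena.CardyFormulaZ2.Theorems.DiscretisationFamilyExists

/-- **Selection of the crossing from the central column (east half).** Columns `j₀, j₀+1, j₀+2`
with event rows `e₀, e₁, e₂` (rows above clean up to `R`, the event cell not clean, room
`eᵢ + 4 ≤ R`; `e₁` maximal), and the central column NOT west-degenerate.  Then one of the seven
clean crossings exists: straight at the bottom of column `j₀`, `j₀+1` or `j₀+2`; a wide L from
column `j₀` or `j₀+1`; a hook from column `j₀+1` or `j₀+2`. [folklore] -/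
theorem select_east {E : DiscreteDobrushin} (hΩ : IsOpen E.Ω)
    (hJE : frontier E.Ω ⊆ closure (closure E.Ω)ᶜ) (hext : IsConnected (closure E.Ω)ᶜ)
    (hunb : ¬ Bornology.IsBounded (closure E.Ω)ᶜ) (hδ : 0 < E.δ) (hne : (frontier E.Ω).Nonempty)
    {j₀ R e₀ e₁ e₂ : ℤ}
    (h0 : ∀ j : ℤ, e₀ < j → j ≤ R → (E.IsInnerFace ![j₀, j] ∧ ¬ (((![j₀, j + 1] : Site 2) ∈ E.zdBoundary) ∧ ((![j₀ + 1, j + 1] : Site 2) ∈ E.zdBoundary)))) (hX0 : ¬ (E.IsInnerFace ![j₀, e₀] ∧ ¬ (((![j₀, e₀ + 1] : Site 2) ∈ E.zdBoundary) ∧ ((![j₀ + 1, e₀ + 1] : Site 2) ∈ E.zdBoundary)))) (he0R : e₀ + 4 ≤ R)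
    (h1 : ∀ j : ℤ, e₁ < j → j ≤ R → (E.IsInnerFace ![j₀ + 1, j] ∧ ¬ (((![j₀ + 1, j + 1] : Site 2) ∈ E.zdBoundary) ∧ ((![j₀ + 2, j + 1] : Site 2) ∈ E.zdBoundary)))) (hX1 : ¬ (E.IsInnerFace ![j₀ + 1, e₁] ∧ ¬ (((![j₀ + 1, e₁ + 1] : Site 2) ∈ E.zdBoundary) ∧ ((![j₀ + 2, e₁ + 1] : Site 2) ∈ E.zdBoundary)))) (he1R : e₁ + 4 ≤ R)
    (hmax1 : ∀ j : ℤ, j ≤ R → ¬ (E.IsInnerFace ![j₀ + 1, j] ∧ ¬ (((![j₀ + 1, j + 1] : Site 2) ∈ E.zdBoundary) ∧ ((![j₀ + 2, j + 1] : Site 2) ∈ E.zdBoundary))) → j ≤ e₁)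
    (h2 : ∀ j : ℤ, e₂ < j → j ≤ R → (E.IsInnerFace ![j₀ + 2, j] ∧ ¬ (((![j₀ + 2, j + 1] : Site 2) ∈ E.zdBoundary) ∧ ((![j₀ + 3, j + 1] : Site 2) ∈ E.zdBoundary)))) (hX2 : ¬ (E.IsInnerFace ![j₀ + 2, e₂] ∧ ¬ (((![j₀ + 2, e₂ + 1] : Site 2) ∈ E.zdBoundary) ∧ ((![j₀ + 3, e₂ + 1] : Site 2) ∈ E.zdBoundary)))) (he2R : e₂ + 4 ≤ R)
    (hnotI : ¬ E.IsInnerFace ![j₀, e₀] → ¬ (E.δ + infDist (meshPoint E.δ ![j₀, e₀ + 1]) (frontier E.Ω) ≤ infDist (meshPoint E.δ ![j₀ + 1, e₀ + 1]) (frontier E.Ω))) :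
    (∃ y' : ℤ, ((∀ j : ℤ, y' ≤ j → j ≤ R → (E.IsInnerFace ![j₀, j] ∧ ¬ (((![j₀, j + 1] : Site 2) ∈ E.zdBoundary) ∧ ((![j₀ + 1, j + 1] : Site 2) ∈ E.zdBoundary)))) ∧ y' ≤ R ∧ ¬ E.IsInnerFace ![j₀, y' - 1] ∧ (¬ (E.δ + infDist (meshPoint E.δ ![j₀, y']) (frontier E.Ω) ≤ infDist (meshPoint E.δ ![j₀ + 1, y']) (frontier E.Ω)) ∧ ¬ (E.δ + infDist (meshPoint E.δ ![j₀ + 1, y']) (frontier E.Ω) ≤ infDist (meshPoint E.δ ![j₀, y']) (frontier E.Ω))))) ∨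
    (∃ y' : ℤ, ((∀ j : ℤ, y' ≤ j → j ≤ R → (E.IsInnerFace ![j₀ + 1, j] ∧ ¬ (((![j₀ + 1, j + 1] : Site 2) ∈ E.zdBoundary) ∧ ((![j₀ + 2, j + 1] : Site 2) ∈ E.zdBoundary)))) ∧ y' ≤ R ∧ ¬ E.IsInnerFace ![j₀ + 1, y' - 1] ∧ (¬ (E.δ + infDist (meshPoint E.δ ![j₀ + 1, y']) (frontier E.Ω) ≤ infDist (meshPoint E.δ ![j₀ + 2, y']) (frontier E.Ω)) ∧ ¬ (E.δ + infDist (meshPoint E.δ ![j₀ + 2, y']) (frontier E.Ω) ≤ infDist (meshPoint E.δ ![j₀ + 1, y']) (frontier E.Ω))))) ∨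
    (∃ y' : ℤ, ((∀ j : ℤ, y' ≤ j → j ≤ R → (E.IsInnerFace ![j₀ + 2, j] ∧ ¬ (((![j₀ + 2, j + 1] : Site 2) ∈ E.zdBoundary) ∧ ((![j₀ + 3, j + 1] : Site 2) ∈ E.zdBoundary)))) ∧ y' ≤ R ∧ ¬ E.IsInnerFace ![j₀ + 2, y' - 1] ∧ (¬ (E.δ + infDist (meshPoint E.δ ![j₀ + 2, y']) (frontier E.Ω) ≤ infDist (meshPoint E.δ ![j₀ + 3, y']) (frontier E.Ω)) ∧ ¬ (E.δ + infDist (meshPoint E.δ ![j₀ + 3, y']) (frontier E.Ω) ≤ infDist (meshPoint E.δ ![j₀ + 2, y']) (frontier E.Ω))))) ∨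
    (∃ h : ℤ, ((∀ j : ℤ, (e₀ + 1) ≤ j → j ≤ R → (E.IsInnerFace ![j₀, j] ∧ ¬ (((![j₀, j + 1] : Site 2) ∈ E.zdBoundary) ∧ ((![j₀ + 1, j + 1] : Site 2) ∈ E.zdBoundary)))) ∧ (e₀ + 1) ≤ h ∧ h ≤ R ∧ E.IsInnerFace ![j₀ + 1, h] ∧ ¬ (((![j₀ + 1, h] : Site 2) ∈ E.zdBoundary) ∧ ((![j₀ + 1, h + 1] : Site 2) ∈ E.zdBoundary)) ∧ ¬ E.IsInnerFace ![j₀ + 2, h] ∧ (¬ (E.δ + infDist (meshPoint E.δ ![j₀ + 2, h]) (frontier E.Ω) ≤ infDist (meshPoint E.δ ![j₀ + 2, h + 1]) (frontier E.Ω)) ∧ ¬ (E.δ + infDist (meshPoint E.δ ![j₀ + 2, h + 1]) (frontier E.Ω) ≤ infDist (meshPoint E.δ ![j₀ + 2, h]) (frontier E.Ω))))) ∨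
    (∃ h : ℤ, ((∀ j : ℤ, (e₁ + 1) ≤ j → j ≤ R → (E.IsInnerFace ![j₀ + 1, j] ∧ ¬ (((![j₀ + 1, j + 1] : Site 2) ∈ E.zdBoundary) ∧ ((![j₀ + 2, j + 1] : Site 2) ∈ E.zdBoundary)))) ∧ (e₁ + 1) ≤ h ∧ h ≤ R ∧ E.IsInnerFace ![j₀ + 2, h] ∧ ¬ (((![j₀ + 2, h] : Site 2) ∈ E.zdBoundary) ∧ ((![j₀ + 2, h + 1] : Site 2) ∈ E.zdBoundary)) ∧ ¬ E.IsInnerFace ![j₀ + 3, h] ∧ (¬ (E.δ + infDist (meshPoint E.δ ![j₀ + 3, h]) (frontier E.Ω) ≤ infDist (meshPoint E.δ ![j₀ + 3, h + 1]) (frontier E.Ω)) ∧ ¬ (E.δ + infDist (meshPoint E.δ ![j₀ + 3, h + 1]) (frontier E.Ω) ≤ infDist (meshPoint E.δ ![j₀ + 3, h]) (frontier E.Ω))))) ∨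
    (∃ h : ℤ, ((∀ j : ℤ, (e₁ + 1) ≤ j → j ≤ R → (E.IsInnerFace ![j₀ + 1, j] ∧ ¬ (((![j₀ + 1, j + 1] : Site 2) ∈ E.zdBoundary) ∧ ((![j₀ + 2, j + 1] : Site 2) ∈ E.zdBoundary)))) ∧ (e₁ + 1) ≤ h + 1 ∧ h + 1 ≤ R ∧ E.IsInnerFace ![j₀ + 2, h + 1] ∧ E.IsInnerFace ![j₀ + 2, h] ∧ ¬ (((![j₀ + 2, h + 1] : Site 2) ∈ E.zdBoundary) ∧ ((![j₀ + 2, h + 2] : Site 2) ∈ E.zdBoundary)) ∧ ¬ (((![j₀ + 2, h + 1] : Site 2) ∈ E.zdBoundary) ∧ ((![j₀ + 3, h + 1] : Site 2) ∈ E.zdBoundary)) ∧ ¬ E.IsInnerFace ![j₀ + 2, h - 1] ∧ (¬ (E.δ + infDist (meshPoint E.δ ![j₀ + 2, h]) (frontier E.Ω) ≤ infDist (meshPoint E.δ ![j₀ + 3, h]) (frontier E.Ω)) ∧ ¬ (E.δ + infDist (meshPoint E.δ ![j₀ + 3, h]) (frontier E.Ω) ≤ infDist (meshPoint E.δ ![j₀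 + 2, h]) (frontier E.Ω))))) ∨
    (∃ h : ℤ, ((∀ j : ℤ, (e₂ + 1) ≤ j → j ≤ R → (E.IsInnerFace ![j₀ + 2, j] ∧ ¬ (((![j₀ + 2, j + 1] : Site 2) ∈ E.zdBoundary) ∧ ((![j₀ + 3, j + 1] : Site 2) ∈ E.zdBoundary)))) ∧ (e₂ + 1) ≤ h + 1 ∧ h + 1 ≤ R ∧ E.IsInnerFace ![j₀ + 3, h + 1] ∧ E.IsInnerFace ![j₀ + 3, h] ∧ ¬ (((![j₀ + 3, h + 1] : Site 2) ∈ E.zdBoundary) ∧ ((![j₀ + 3, h + 2] : Site 2) ∈ E.zdBoundary)) ∧ ¬ (((![j₀ + 3, h + 1] : Site 2) ∈ E.zdBoundary) ∧ ((![j₀ + 4, h + 1] : Site 2) ∈ E.zdBoundary)) ∧ ¬ E.IsInnerFace ![j₀ + 3, h - 1] ∧ (¬ (E.δ + infDist (meshPoint E.δ ![j₀ + 3, h]) (frontier E.Ω) ≤ infDist (meshPoint E.δ ![j₀ + 4, h]) (frontier E.Ω)) ∧ ¬ (E.δ + infDist (meshPoint E.δ ![j₀ + 4, h]) (frontier E.Ω)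 ≤ infDist (meshPoint E.δ ![j₀ + 3, h]) (frontier E.Ω))))) := by
  set δ := E.δ with hδdef
  by_cases hα : E.IsInnerFace ![j₀, e₀]
  swap
  · ----------------------------------------------------------------
    -- the central column ends at a face-boundary edge (type α)
    by_cases hnd : (¬ (E.δ + infDist (meshPoint E.δ ![j₀, e₀ + 1]) (frontier E.Ω) ≤ infDist (meshPoint E.δ ![j₀ + 1, e₀ + 1]) (frontier E.Ω)) ∧ ¬ (E.δ + infDist (meshPoint E.δ ![j₀ + 1, e₀ + 1]) (frontier E.Ω) ≤ infDist (meshPoint E.δ ![j₀, e₀ + 1]) (frontier E.Ω)))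
    · refine Or.inl ⟨e₀ + 1, fun j hj hjR => h0 j (by omega) hjR, by omega, by simpa using hα, hnd⟩
    have hdeg : δ + infDist (meshPoint E.δ ![j₀ + 1, e₀ + 1]) (frontier E.Ω) ≤ infDist (meshPoint E.δ ![j₀, e₀ + 1]) (frontier E.Ω) := by
      by_contra hB; exact hnd ⟨hnotI hα, hB⟩
    rcases resolve_degII hΩ hJE hext hunb hδ hne (J := j₀) (y := e₀ + 1) (R := R) (e' := e₁) (by omega)
      (fun j hj hjR => h0 j (by omega) hjR) (by simpa using hα) hdeg he1R h1 hX1 with ⟨y', hy'⟩ | ⟨h, hh⟩ | ⟨h, hh⟩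
    · exact Or.inr (Or.inl ⟨y', hy'⟩)
    · exact Or.inr (Or.inr (Or.inr (Or.inl ⟨h, hh⟩)))
    · exact Or.inr (Or.inr (Or.inr (Or.inr (Or.inr (Or.inl ⟨h, hh⟩)))))
  · ----------------------------------------------------------------
    -- the central column ends at a chord (type β)
    have hch : ((![j₀, e₀ + 1] : Site 2) ∈ E.zdBoundary) ∧ ((![j₀ + 1, e₀ + 1] : Site 2) ∈ E.zdBoundary) := by
      by_contra hch; exact hX0 ⟨hα, hch⟩
    have hσ : E.IsInnerFace ![j₀, e₀ + 1] := (h0 (e₀ + 1) (by omega) (by omega)).1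
    -- one of the two east cells at the chord end `x₁` is not inner
    have hx₁ : ¬ E.IsInnerFace ![j₀ + 1, e₀ + 1] ∨ ¬ E.IsInnerFace ![j₀ + 1, e₀] := by
      by_contra h
      push Not at h
      refine not_mem_zdBoundary_of_four (E := E) (j₀ + 1) (e₀ + 1) h.1 ?_ ?_ ?_ hch.2
      · simpa using hσ
      · simpa using hα
      · simpa using h.2
    have he₁ : e₀ ≤ e₁ := by
      rcases hx₁ with h | h
      · exact (hmax1 (e₀ + 1) (by omega) (fun hc => h hc.1)).trans' (by omega)
      · exact hmax1 e₀ (by omega) (fun hc => h hc.1)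
    rcases eq_or_lt_of_le he₁ with he | he
    · -- `e₁ = e₀`: straight at the bottom of column `j₀+1`, or it is east-degenerate
      have hσ' : E.IsInnerFace ![j₀ + 1, e₀ + 1] := (h1 (e₀ + 1) (by omega) (by omega)).1
      have hg' : ¬ E.IsInnerFace ![j₀ + 1, e₀] := by
        rcases hx₁ with h | h
        · exact absurd hσ' h
        · exact h
      obtain ⟨-, hw₂⟩ := mem_zdBoundary_of_inner_not_inner_below (k := j₀ + 1) (j := e₀ + 1) hσ' (by simpa using hg')
      rw [show j₀ + 1 + 1 = j₀ + 2 by ring] at hw₂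
      by_cases hnd : (¬ (E.δ + infDist (meshPoint E.δ ![j₀ + 1, e₀ + 1]) (frontier E.Ω) ≤ infDist (meshPoint E.δ ![j₀ + 2, e₀ + 1]) (frontier E.Ω)) ∧ ¬ (E.δ + infDist (meshPoint E.δ ![j₀ + 2, e₀ + 1]) (frontier E.Ω) ≤ infDist (meshPoint E.δ ![j₀ + 1, e₀ + 1]) (frontier E.Ω)))
      · refine Or.inr (Or.inl ⟨e₀ + 1, fun j hj hjR => h1 j (by omega) hjR, by omega, by simpa using hg', ?_⟩)
        simpa [show j₀ + 1 + 1 = j₀ + 2 by ring] using hnd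
      have hA := not_degenerate_west_of_inner hΩ hJE hext hunb hδ hne (K := j₀) (j := e₀ + 1)
        (by simpa using hα) hσ hch.2 hw₂
      have hdeg : δ + infDist (meshPoint E.δ ![j₀ + 2, e₀ + 1]) (frontier E.Ω) ≤ infDist (meshPoint E.δ ![j₀ + 1, e₀ + 1]) (frontier E.Ω) := by
        by_contra hB; exact hnd ⟨hA, hB⟩
      rcases resolve_degII hΩ hJE hext hunb hδ hne (J := j₀ + 1) (y := e₀ + 1) (R := R) (e' := e₂) (by omega)
        (fun j hj hjR => by simpa [show j₀ + 1 + 1 = j₀ + 2 by ring] using h1 j (by omega) hjR)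
        (by simpa using hg') (by simpa [show j₀ + 1 + 1 = j₀ + 2 by ring] using hdeg) he2R
        (fun j hj hjR => by simpa [show j₀ + 1 + 1 = j₀ + 2 by ring, show j₀ + 1 + 2 = j₀ + 3 by ring] using h2 j hj hjR)
        (by simpa [show j₀ + 1 + 1 = j₀ + 2 by ring, show j₀ + 1 + 2 = j₀ + 3 by ring] using hX2) with ⟨y', hy'⟩ | ⟨h, hh⟩ | ⟨h, hh⟩
      · refine Or.inr (Or.inr (Or.inl ⟨y', ?_⟩))
        simp only [show j₀ + 1 + 1 = j₀ + 2 by ring, show j₀ + 1 + 2 = j₀ + 3 by ring] at hy'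
        exact hy'
      · refine Or.inr (Or.inr (Or.inr (Or.inr (Or.inl ⟨h, ?_⟩))))
        rw [← he]
        simp only [show j₀ + 1 + 1 = j₀ + 2 by ring, show j₀ + 1 + 2 = j₀ + 3 by ring] at hh
        exact hh
      · refine Or.inr (Or.inr (Or.inr (Or.inr (Or.inr (Or.inr ⟨h, ?_⟩)))))
        simp only [show j₀ + 1 + 1 = j₀ + 2 by ring, show j₀ + 1 + 2 = j₀ + 3 by ring,
          show j₀ + 1 + 3 = j₀ + 4 by ring] at hh
        exact hh
    · -- `e₀ < e₁`: the obstacle of column `j₀+1` is a non-inner cell at a row `≥ e₀ + 1`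
      have hXi : ¬ E.IsInnerFace ![j₀ + 1, e₁] := by
        intro hXi
        apply hX1
        refine ⟨hXi, fun hc => ?_⟩
        refine not_mem_zdBoundary_of_four (E := E) (j₀ + 1) (e₁ + 1) (h1 (e₁ + 1) (by omega) (by omega)).1 ?_ ?_ ?_ hc.1
        · simpa using (h0 (e₁ + 1) (by omega) (by omega)).1
        · simpa using (h0 e₁ (by omega) (by omega)).1
        · simpa using hXi
      have hw1i : E.IsInnerFace ![j₀ + 1, e₁ + 1] := (h1 (e₁ + 1) (by omega) (by omega)).1
      obtain ⟨hw₁, hw₂⟩ := mem_zdBoundary_of_inner_not_inner_below (k := j₀ + 1) (j := e₁ + 1) hw1i (by simpa using hXi)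
      rw [show j₀ + 1 + 1 = j₀ + 2 by ring] at hw₂
      by_cases hnd : (¬ (E.δ + infDist (meshPoint E.δ ![j₀ + 1, e₁ + 1]) (frontier E.Ω) ≤ infDist (meshPoint E.δ ![j₀ + 2, e₁ + 1]) (frontier E.Ω)) ∧ ¬ (E.δ + infDist (meshPoint E.δ ![j₀ + 2, e₁ + 1]) (frontier E.Ω) ≤ infDist (meshPoint E.δ ![j₀ + 1, e₁ + 1]) (frontier E.Ω)))
      · refine Or.inr (Or.inl ⟨e₁ + 1, fun j hj hjR => h1 j (by omega) hjR, by omega, by simpa using hXi, ?_⟩)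
        simpa [show j₀ + 1 + 1 = j₀ + 2 by ring] using hnd
      have hA := not_degenerate_west_of_inner hΩ hJE hext hunb hδ hne (K := j₀) (j := e₁ + 1)
        (by simpa using (h0 e₁ (by omega) (by omega)).1) (h0 (e₁ + 1) (by omega) (by omega)).1 hw₁ hw₂
      have hdeg : δ + infDist (meshPoint E.δ ![j₀ + 2, e₁ + 1]) (frontier E.Ω) ≤ infDist (meshPoint E.δ ![j₀ + 1, e₁ + 1]) (frontier E.Ω) := by
        by_contra hB; exact hnd ⟨hA, hB⟩
      rcases resolve_degII hΩ hJE hext hunb hδ hne (J := j₀ + 1) (y := e₁ + 1) (R := R) (e' := e₂) (by omega)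
        (fun j hj hjR => by simpa [show j₀ + 1 + 1 = j₀ + 2 by ring] using h1 j (by omega) hjR)
        (by simpa using hXi) (by simpa [show j₀ + 1 + 1 = j₀ + 2 by ring] using hdeg) he2R
        (fun j hj hjR => by simpa [show j₀ + 1 + 1 = j₀ + 2 by ring, show j₀ + 1 + 2 = j₀ + 3 by ring] using h2 j hj hjR)
        (by simpa [show j₀ + 1 + 1 = j₀ + 2 by ring, show j₀ + 1 + 2 = j₀ + 3 by ring] using hX2) with ⟨y', hy'⟩ | ⟨h, hh⟩ | ⟨h, hh⟩
      · refine Or.inr (Or.inr (Or.inl ⟨y', ?_⟩))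
        simp only [show j₀ + 1 + 1 = j₀ + 2 by ring, show j₀ + 1 + 2 = j₀ + 3 by ring] at hy'
        exact hy'
      · refine Or.inr (Or.inr (Or.inr (Or.inr (Or.inl ⟨h, ?_⟩))))
        simp only [show j₀ + 1 + 1 = j₀ + 2 by ring, show j₀ + 1 + 2 = j₀ + 3 by ring] at hh
        exact hh
      · refine Or.inr (Or.inr (Or.inr (Or.inr (Or.inr (Or.inr ⟨h, ?_⟩)))))
        simp only [show j₀ + 1 + 1 = j₀ + 2 by ring, show j₀ + 1 + 2 = j₀ + 3 by ring,
          show j₀ + 1 + 3 = j₀ + 4 by ring] at hh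
        exact hh

/-! ### Event rows of a column -/

/-- **Top rows of a column inside a deep block are clean.** If all cells `(k', j')` with
`k - 1 ≤ k' ≤ k` and `R - 5 ≤ j' ≤ R + 1` are inner, the cells `(k, j)`, `R - 4 ≤ j ≤ R`, are
clean (inner, top side not a chord: its west end has four inner cells). [folklore] -/
theorem clean_of_deep {E : DiscreteDobrushin} {k R : ℤ}
    (hdeep : ∀ k' j' : ℤ, k - 1 ≤ k' → k' ≤ k → R - 5 ≤ j' → j' ≤ R + 1 → E.IsInnerFace ![k', j']) :
    ∀ j : ℤ, R - 4 ≤ j → j ≤ R → (E.IsInnerFace ![k, j] ∧ ¬ (((![k, j + 1] : Site 2) ∈ E.zdBoundary) ∧ ((![k + 1, j + 1] : Site 2) ∈ E.zdBoundary))) := by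
  intro j hj hjR
  refine ⟨hdeep k j (by omega) le_rfl (by omega) (by omega), fun h => ?_⟩
  refine not_mem_zdBoundary_of_four (E := E) k (j + 1) (hdeep k (j + 1) (by omega) le_rfl (by omega) (by omega))
    (hdeep (k - 1) (j + 1) (by omega) (by omega) (by omega) (by omega)) ?_ ?_ h.1
  · simpa using hdeep (k - 1) j (by omega) (by omega) (by omega) (by omega)
  · simpa using hdeep k j (by omega) le_rfl (by omega) (by omega)

/-- **The event row of a column.** If the cells `(k, j)`, `R - 4 ≤ j ≤ R`, are clean and the cell
`(k, j₁)` (`j₁ + 5 ≤ R`) is not inner, there is an EVENT ROW `e`, `j₁ ≤ e ≤ R - 5`: the rows above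
it up to `R` are clean, `(k, e)` is not clean, and every non-clean row `≤ R` is `≤ e`. [folklore] -/
theorem exists_event {E : DiscreteDobrushin} {k R j₁ : ℤ} (hj₁ : j₁ + 5 ≤ R)
    (htop : ∀ j : ℤ, R - 4 ≤ j → j ≤ R → (E.IsInnerFace ![k, j] ∧ ¬ (((![k, j + 1] : Site 2) ∈ E.zdBoundary) ∧ ((![k + 1, j + 1] : Site 2) ∈ E.zdBoundary))))
    (hbot : ¬ E.IsInnerFace ![k, j₁]) :
    ∃ e : ℤ, j₁ ≤ e ∧ e + 5 ≤ R ∧ (∀ j : ℤ, e < j → j ≤ R → (E.IsInnerFace ![k, j] ∧ ¬ (((![k, j + 1] : Site 2) ∈ E.zdBoundary) ∧ ((![k + 1, j + 1] : Site 2) ∈ E.zdBoundary)))) ∧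
      ¬ (E.IsInnerFace ![k, e] ∧ ¬ (((![k, e + 1] : Site 2) ∈ E.zdBoundary) ∧ ((![k + 1, e + 1] : Site 2) ∈ E.zdBoundary))) ∧ (∀ j : ℤ, j ≤ R → ¬ (E.IsInnerFace ![k, j] ∧ ¬ (((![k, j + 1] : Site 2) ∈ E.zdBoundary) ∧ ((![k + 1, j + 1] : Site 2) ∈ E.zdBoundary))) → j ≤ e) := by
  classical
  set S : Finset ℤ := (Finset.Icc j₁ R).filter (fun j => ¬ (E.IsInnerFace ![k, j] ∧ ¬ (((![k, j + 1] : Site 2) ∈ E.zdBoundary) ∧ ((![k + 1, j + 1] : Site 2) ∈ E.zdBoundary)))) with hS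
  have hj₁S : j₁ ∈ S := by
    rw [hS, Finset.mem_filter, Finset.mem_Icc]
    exact ⟨⟨le_rfl, by omega⟩, fun h => hbot h.1⟩
  have hSne : S.Nonempty := ⟨j₁, hj₁S⟩
  set e := S.max' hSne with he
  have heS : e ∈ S := Finset.max'_mem S hSne
  rw [hS, Finset.mem_filter, Finset.mem_Icc] at heS
  have hmax : ∀ j : ℤ, j ≤ R → ¬ (E.IsInnerFace ![k, j] ∧ ¬ (((![k, j + 1] : Site 2) ∈ E.zdBoundary) ∧ ((![k + 1, j + 1] : Site 2) ∈ E.zdBoundary))) → j ≤ e := by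
    intro j hjR hj
    by_cases hjj : j₁ ≤ j
    · exact Finset.le_max' S j (by rw [hS, Finset.mem_filter, Finset.mem_Icc]; exact ⟨⟨hjj, hjR⟩, hj⟩)
    · exact le_trans (by omega) heS.1.1
  have heR : e + 5 ≤ R := by
    by_contra h
    exact heS.2 (htop e (by omega) heS.1.2)
  refine ⟨e, heS.1.1, heR, fun j hj hjR => ?_, heS.2, hmax⟩
  by_contra h
  have := hmax j hjR h
  omega

/-- **The selection from a deep block (east half).** Deep block: all cells `(k, j)` with
`j₀ - 1 ≤ k ≤ j₀ + 3`, `R - 5 ≤ j ≤ R + 1` inner; exterior row: the cells `(k, j₁)`,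
`j₀ ≤ k ≤ j₀ + 2`, not inner (`j₁ + 5 ≤ R`); the central column not west-degenerate at its event
row.  Then event rows `e₀, e₁, e₂ ∈ [j₁, R - 5]` of columns `j₀, j₀+1, j₀+2` exist for which one of
the seven clean crossings of `select_east` holds. [folklore] -/
theorem select_east_of_deep {E : DiscreteDobrushin} (hΩ : IsOpen E.Ω)
    (hJE : frontier E.Ω ⊆ closure (closure E.Ω)ᶜ) (hext : IsConnected (closure E.Ω)ᶜ)
    (hunb : ¬ Bornology.IsBounded (closure E.Ω)ᶜ) (hδ : 0 < E.δ) (hne : (frontier E.Ω).Nonempty)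
    {j₀ R j₁ : ℤ} (hj₁ : j₁ + 5 ≤ R)
    (hdeep : ∀ k j : ℤ, j₀ - 1 ≤ k → k ≤ j₀ + 3 → R - 5 ≤ j → j ≤ R + 1 → E.IsInnerFace ![k, j])
    (hbot : ∀ k : ℤ, j₀ ≤ k → k ≤ j₀ + 2 → ¬ E.IsInnerFace ![k, j₁])
    (hnotI : ∀ e₀ : ℤ, j₁ ≤ e₀ → e₀ + 5 ≤ R → (∀ j : ℤ, e₀ < j → j ≤ R → (E.IsInnerFace ![j₀, j] ∧ ¬ (((![j₀, j + 1] : Site 2) ∈ E.zdBoundary) ∧ ((![j₀ + 1, j + 1] : Site 2) ∈ E.zdBoundary)))) →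
      ¬ (E.IsInnerFace ![j₀, e₀] ∧ ¬ (((![j₀, e₀ + 1] : Site 2) ∈ E.zdBoundary) ∧ ((![j₀ + 1, e₀ + 1] : Site 2) ∈ E.zdBoundary))) → ¬ E.IsInnerFace ![j₀, e₀] →
      ¬ (E.δ + infDist (meshPoint E.δ ![j₀, e₀ + 1]) (frontier E.Ω) ≤ infDist (meshPoint E.δ ![j₀ + 1, e₀ + 1]) (frontier E.Ω))) :
    ∃ e₀ e₁ e₂ : ℤ, j₁ ≤ e₀ ∧ e₀ + 5 ≤ R ∧ j₁ ≤ e₁ ∧ e₁ + 5 ≤ R ∧ j₁ ≤ e₂ ∧ e₂ + 5 ≤ R ∧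
    ((∃ y' : ℤ, ((∀ j : ℤ, y' ≤ j → j ≤ R → (E.IsInnerFace ![j₀, j] ∧ ¬ (((![j₀, j + 1] : Site 2) ∈ E.zdBoundary) ∧ ((![j₀ + 1, j + 1] : Site 2) ∈ E.zdBoundary)))) ∧ y' ≤ R ∧ ¬ E.IsInnerFace ![j₀, y' - 1] ∧ (¬ (E.δ + infDist (meshPoint E.δ ![j₀, y']) (frontier E.Ω) ≤ infDist (meshPoint E.δ ![j₀ + 1, y']) (frontier E.Ω)) ∧ ¬ (E.δ + infDist (meshPoint E.δ ![j₀ + 1, y']) (frontier E.Ω) ≤ infDist (meshPoint E.δ ![j₀, y']) (frontier E.Ω))))) ∨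
    (∃ y' : ℤ, ((∀ j : ℤ, y' ≤ j → j ≤ R → (E.IsInnerFace ![j₀ + 1, j] ∧ ¬ (((![j₀ + 1, j + 1] : Site 2) ∈ E.zdBoundary) ∧ ((![j₀ + 2, j + 1] : Site 2) ∈ E.zdBoundary)))) ∧ y' ≤ R ∧ ¬ E.IsInnerFace ![j₀ + 1, y' - 1] ∧ (¬ (E.δ + infDist (meshPoint E.δ ![j₀ + 1, y']) (frontier E.Ω) ≤ infDist (meshPoint E.δ ![j₀ + 2, y']) (frontier E.Ω)) ∧ ¬ (E.δ + infDist (meshPoint E.δ ![j₀ + 2, y']) (frontier E.Ω) ≤ infDist (meshPoint E.δ ![j₀ + 1, y']) (frontier E.Ω))))) ∨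
    (∃ y' : ℤ, ((∀ j : ℤ, y' ≤ j → j ≤ R → (E.IsInnerFace ![j₀ + 2, j] ∧ ¬ (((![j₀ + 2, j + 1] : Site 2) ∈ E.zdBoundary) ∧ ((![j₀ + 3, j + 1] : Site 2) ∈ E.zdBoundary)))) ∧ y' ≤ R ∧ ¬ E.IsInnerFace ![j₀ + 2, y' - 1] ∧ (¬ (E.δ + infDist (meshPoint E.δ ![j₀ + 2, y']) (frontier E.Ω) ≤ infDist (meshPoint E.δ ![j₀ + 3, y']) (frontier E.Ω)) ∧ ¬ (E.δ + infDist (meshPoint E.δ ![j₀ + 3, y']) (frontier E.Ω) ≤ infDist (meshPoint E.δ ![j₀ + 2, y']) (frontier E.Ω))))) ∨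
    (∃ h : ℤ, ((∀ j : ℤ, (e₀ + 1) ≤ j → j ≤ R → (E.IsInnerFace ![j₀, j] ∧ ¬ (((![j₀, j + 1] : Site 2) ∈ E.zdBoundary) ∧ ((![j₀ + 1, j + 1] : Site 2) ∈ E.zdBoundary)))) ∧ (e₀ + 1) ≤ h ∧ h ≤ R ∧ E.IsInnerFace ![j₀ + 1, h] ∧ ¬ (((![j₀ + 1, h] : Site 2) ∈ E.zdBoundary) ∧ ((![j₀ + 1, h + 1] : Site 2) ∈ E.zdBoundary)) ∧ ¬ E.IsInnerFace ![j₀ + 2, h] ∧ (¬ (E.δ + infDist (meshPoint E.δ ![j₀ + 2, h]) (frontier E.Ω) ≤ infDist (meshPoint E.δ ![j₀ + 2, h + 1]) (frontier E.Ω)) ∧ ¬ (E.δ + infDist (meshPoint E.δ ![j₀ + 2, h + 1]) (frontier E.Ω) ≤ infDist (meshPoint E.δ ![j₀ + 2, h]) (frontier E.Ω))))) ∨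
    (∃ h : ℤ, ((∀ j : ℤ, (e₁ + 1) ≤ j → j ≤ R → (E.IsInnerFace ![j₀ + 1, j] ∧ ¬ (((![j₀ + 1, j + 1] : Site 2) ∈ E.zdBoundary) ∧ ((![j₀ + 2, j + 1] : Site 2) ∈ E.zdBoundary)))) ∧ (e₁ + 1) ≤ h ∧ h ≤ R ∧ E.IsInnerFace ![j₀ + 2, h] ∧ ¬ (((![j₀ + 2, h] : Site 2) ∈ E.zdBoundary) ∧ ((![j₀ + 2, h + 1] : Site 2) ∈ E.zdBoundary)) ∧ ¬ E.IsInnerFace ![j₀ + 3, h] ∧ (¬ (E.δ + infDist (meshPoint E.δ ![j₀ + 3, h]) (frontier E.Ω) ≤ infDist (meshPoint E.δ ![j₀ + 3, h + 1]) (frontier E.Ω)) ∧ ¬ (E.δ + infDist (meshPoint E.δ ![j₀ + 3, h + 1]) (frontier E.Ω) ≤ infDist (meshPoint E.δ ![j₀ + 3, h]) (frontier E.Ω))))) ∨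
    (∃ h : ℤ, ((∀ j : ℤ, (e₁ + 1) ≤ j → j ≤ R → (E.IsInnerFace ![j₀ + 1, j] ∧ ¬ (((![j₀ + 1, j + 1] : Site 2) ∈ E.zdBoundary) ∧ ((![j₀ + 2, j + 1] : Site 2) ∈ E.zdBoundary)))) ∧ (e₁ + 1) ≤ h + 1 ∧ h + 1 ≤ R ∧ E.IsInnerFace ![j₀ + 2, h + 1] ∧ E.IsInnerFace ![j₀ + 2, h] ∧ ¬ (((![j₀ + 2, h + 1] : Site 2) ∈ E.zdBoundary) ∧ ((![j₀ + 2, h + 2] : Site 2) ∈ E.zdBoundary)) ∧ ¬ (((![j₀ + 2, h + 1] : Site 2) ∈ E.zdBoundary) ∧ ((![j₀ + 3, h + 1] : Site 2) ∈ E.zdBoundary)) ∧ ¬ E.IsInnerFace ![j₀ + 2, h - 1] ∧ (¬ (E.δ + infDist (meshPoint E.δ ![j₀ + 2, h]) (frontier E.Ω) ≤ infDist (meshPoint E.δ ![j₀ + 3, h]) (frontier E.Ω)) ∧ ¬ (E.δ + infDist (meshPoint E.δ ![j₀ + 3, h]) (frontier E.Ω) ≤ infDist (meshPoint E.δ ![j₀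 + 2, h]) (frontier E.Ω))))) ∨
    (∃ h : ℤ, ((∀ j : ℤ, (e₂ + 1) ≤ j → j ≤ R → (E.IsInnerFace ![j₀ + 2, j] ∧ ¬ (((![j₀ + 2, j + 1] : Site 2) ∈ E.zdBoundary) ∧ ((![j₀ + 3, j + 1] : Site 2) ∈ E.zdBoundary)))) ∧ (e₂ + 1) ≤ h + 1 ∧ h + 1 ≤ R ∧ E.IsInnerFace ![j₀ + 3, h + 1] ∧ E.IsInnerFace ![j₀ + 3, h] ∧ ¬ (((![j₀ + 3, h + 1] : Site 2) ∈ E.zdBoundary) ∧ ((![j₀ + 3, h + 2] : Site 2) ∈ E.zdBoundary)) ∧ ¬ (((![j₀ + 3, h + 1] : Site 2) ∈ E.zdBoundary) ∧ ((![j₀ + 4, h + 1] : Site 2) ∈ E.zdBoundary)) ∧ ¬ E.IsInnerFace ![j₀ + 3, h - 1] ∧ (¬ (E.δ + infDist (meshPoint E.δ ![j₀ + 3, h]) (frontier E.Ω) ≤ infDist (meshPoint E.δ ![j₀ + 4, h]) (frontier E.Ω)) ∧ ¬ (E.δ + infDist (meshPoint E.δ ![j₀ + 4, h]) (frontier E.Ω)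 ≤ infDist (meshPoint E.δ ![j₀ + 3, h]) (frontier E.Ω)))))) := by
  obtain ⟨e₀, h0l, h0R, h0, hX0, -⟩ := exists_event (E := E) (k := j₀) hj₁
    (clean_of_deep fun k' j' h1 h2 h3 h4 => hdeep k' j' (by omega) (by omega) h3 h4) (hbot j₀ le_rfl (by omega))
  obtain ⟨e₁, h1l, h1R, h1, hX1, hmax1⟩ := exists_event (E := E) (k := j₀ + 1) hj₁
    (clean_of_deep fun k' j' h1 h2 h3 h4 => hdeep k' j' (by omega) (by omega) h3 h4) (hbot (j₀ + 1) (by omega) (by omega))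
  obtain ⟨e₂, h2l, h2R, h2, hX2, -⟩ := exists_event (E := E) (k := j₀ + 2) hj₁
    (clean_of_deep fun k' j' h1 h2 h3 h4 => hdeep k' j' (by omega) (by omega) h3 h4) (hbot (j₀ + 2) (by omega) le_rfl)
  refine ⟨e₀, e₁, e₂, h0l, h0R, h1l, h1R, h2l, h2R, ?_⟩
  simp only [show j₀ + 1 + 1 = j₀ + 2 by ring] at h1 hX1 hmax1
  simp only [show j₀ + 2 + 1 = j₀ + 3 by ring] at h2 hX2
  exact select_east hΩ hJE hext hunb hδ hne h0 hX0 (by omega) h1 hX1 (by omega) hmax1 h2 hX2 (by omega)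
    (hnotI e₀ h0l h0R h0 hX0)

end Summit.CriticalPhenomena.CardyFormulaZ2.Theorems.DiscretisationFamilyExists

end
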